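import Literature.AnabelianGeometry.EtaleTheta.Discharge.Sec5ConstantsDictionaryWitnessFacts
import Mathlib.Topology.Algebra.Module.Cardinality

/-!
# [EtTh] §5 ↔ §3: what the ONE binder `hD : ConstantsDictionary …` FORCES on a §5 datum — the constants of `𝔉` ARE `K^×`; hence NO countable carrier (Def. 3.6 (iii)/(iv) p.304, Lemma 5.8 p.331 / PDF pp.78, 105)

S. Mochizuki, *The étale theta function and its Frobenioid-theoretic manifestations*, Publ. RIMS **45** (2009) [MochizukiEtTh2009],
Def. 3.6 (iii) p.304 (PDF p.78) (the constant field `K` of the tempered Frobenioid; (iv) the base-field-theoretic hull `C^{bs-fld}`),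
Lemma 5.8 p.331 (PDF p.105) ("the natural inclusion `K^× ↪ O^×(B_N^birat)`"; "`Π^tp_Y` [i.e., `G_K`, via the natural surjection
`Π^tp_Y ↠ G_K`] acts"), §5 p.322 (PDF p.96) ("geometrically connected over the field `K = K̈`").
[cite: MochizukiEtTh2009, Def 3.6 (iii)(iv) p.304 (PDF p.78); Lem 5.8 p.331 (PDF p.105)]

abc-iut cell, layer L2 = [EtTh], seat abc-iut-L2-t11 (gen 10; the author lineage of the predicate
`ThetaFrobenioid.BiratAutAction.ConstantsDictionary`, `ConstantsDictionary.lean` p439403, and of its non-vacuity witness `CnstToy.datum`,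
`ConstantsDictionaryWitness.lean` / `Discharge/Sec5ConstantsDictionaryWitnessFacts.lean`).  Row «CONST-DICT ∀-CLOSURE CERTIFICATE + COUNT
CENSUS Lem5.8/Thm5.10(ii)(iii)» (abc-iut-L2-lead R1086 GO, R1112; VNEXT §G5 add.12 «CONST-DICT@Ÿ-JUNCTION»: the G-class cluster
`{hD, hconst, hinvc}` of model-instantiation inputs of the cone rows EtTh:Lem5.8 (`lem58_node_ofThetaSettingYdd_of_constantsDictionary`,
p490511) and EtTh:Thm5.10(ii)(iii) / Thm 5.7 `hgc`).  PROOF-ONLY (0 definitions, no instance, no notation, no new `Prop` fact); nothing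
landed is edited or restated; abc-iut-L2-t11's predicate and toy, abc-iut-L2-t4's `ThetaFrobenioid`, abc-iut-L2-t8's `Cu.thetaEnvData`,
abc-iut-L2-d1's `SettingModel.doubleUnderlineχSec` / `ThetaSetting.modelχ_sec2Hyps` / `SettingModel.modelχ_nonempty_cyclotomeMod` are
consumed BY NAME.

WHICH JUNCTION CLAUSE, AT WHICH DATA (abc-iut-L2-lead R1086).  The clause shown UNPRODUCIBLE is `hD` ALONE — `hconst` («`Aut_C(B_N)` fixes
`K^×`») and `hinvc` are untouched (both hold at the toy datum, `CnstToy.actHom_constEmb`).  The data at which `hD` is unproducible: EVERY §5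
datum `𝔉 : ThetaFrobenioid C₀ D₀` — whatever `α, ι, m` and whatever candidate constants `Cst ≤ O^×(B_N^birat)` and reading
`ν̃ : Cst → ℚ̄_p^×` — whose group of birational units `O^×(B_N^birat) = 𝔉.biratUnits 𝔉.BN` is COUNTABLE, or whose constant field `𝔉.K` is
countable (`not_constantsDictionary_of_countable_biratUnits` / `_of_countable_K` / `_of_countable_Cst`).  In particular at every junction
datum `ofThetaSettingData μ hC hS h Q R K' constEmb …` (abc-iut-L2-t4, `Discharge/Sec5Lem58NodeAtThetaSettingYdd.lean`) over a tempered
Frobenioid `tf` whose `tf.biratUnitsModel R.BN = (tf.ratFnFunctor.obj (op R.BN.base))ˣ` is countable — as it is for the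
`LogDivisorModel` tower skeletons of record whose function groups are finitely generated (Tate tower `Fn = ℤ × ℤ`,
`LogDivisorModelTateTower.lean`; `μ₂ × ℤ³` with `Θ̈`, `LogDivisorModelTateTowerTheta.lean`; Kummer / twist levels `A × ℤ^k` with `A` a
FINITE group of roots of unity) — NO choice of `K'`, `constEmb`, `Cst`, `ν̃` yields `hD` there.  NOT touched by the no-go (they pass the
necessary condition `#O^×(B_N^birat) ≥ 𝔠`): carriers whose functions contain a `p`-adic unit group (`LogDivisorModelOneComponent.lean`,
`Fn := U × ℤ` with `U := O_L^×`) and abc-iut-L2-d3's `C^{bs-fld}`-hull design with genuine `ℚ̄_p`-constants (abc-iut-L2-lead R1112).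

WHY (the structural content, `ConstantsDictionary.exists_mulEquiv_constUnits_unitsK`): the laws `reaches_K` + `constEmb_read` + `injective`
of the predicate say exactly that the reading `ν̃ ∘ (K^× ↪ O^×(B_N^birat))` is a group ISOMORPHISM `𝔉.K^× ⥲ K^×` onto the units of the
setting's base field `K ⊆ ℚ̄_p` — print's Def. 3.6 (iii) «the constant field is `K`» made a THEOREM of the predicate; and `K ⊇ ℚ_p` is
uncountable (`𝔠 ≤ #ℚ_p`, Mathlib `continuum_le_cardinal_of_nontriviallyNormedField`; `ThetaSetting.uncountable_units_K`).  So `hD` forces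
`Cst`, `O^×(B_N^birat)`, `𝔉.K^×`, `𝔉.K` UNCOUNTABLE (`ConstantsDictionary.uncountable_Cst` / `_biratUnits` / `_constUnits` / `_K`).

THE ∀-CLOSURE «every §5 datum over a theta setting's §2 model admits a constants dictionary» is REFUTED AS A SCHEMA, closed form, at the
record model `modelχ p` (`not_forall_exists_constantsDictionary`): the witness is this lineage's toy datum `CnstToy.datum` (constants `J_N`,
`Aut_C(B_N) = μ_N(J_N) ⋊ Γ`, `ρ`, `s^⊓-gp_N := inr`, natural action `actHom`, `ι := refl`, `m := muEquiv`) with its constant field `K`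
REPLACED by the countable field `ℚ` (`ℚ^× ↪ K^× ↪ J_N^×`) — a legitimate inhabitant of abc-iut-L2-t4's FREE structure `ThetaFrobenioid`
(whose field `K` is an arbitrary field with an injective `K^× ↪ O^×(B_N^birat)`).  CENSUS PAIR (R981 standard «∀-closure refuted + honest-slot
instance proved»): the instance of record is `CnstToy.constantsDictionary_datum` / `exists_constantsDictionary_modelχ` (p440032 lineage,
`Discharge/Sec5ConstantsDictionaryWitnessFacts.lean`) and, with sections, `CnstToy.datum′` (p469903 / p470050).

HONEST FRAMING: kernel facts about OUR typed predicate and OUR model class (which carriers can / cannot host the dictionary binder); the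
tempered Frobenioid of an actual Tate curve (whose birational function field is uncountable and DOES have constant field `K`) is not in the
tree; nothing of [EtTh] (a refereed paper) is asserted or denied; no side is taken on [IUTchIII] Cor. 3.12; typed ≠ proved;
discharged-at-our-data ≠ endorsed.
-/

noncomputable section

namespace Literature.AnabelianGeometry.EtaleTheta

open CategoryTheory Literature.AnabelianGeometry.SemiGraphs Cardinal

universe w u u' v'

/-! ### The setting's base field `K ⊇ ℚ_p` is uncountable -/

namespace ThetaSetting

variable {p : ℕ} [Fact p.Prime]

/-- The base field `K ⊆ ℚ̄_p` of a theta setting ("`K` a finite extension of `ℚ_p`", §1 p.237 (PDF p.11)) is UNCOUNTABLE: `ℚ_p ↪ K` and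
`𝔠 ≤ #ℚ_p` (a complete nontrivially normed field).  [cite: MochizukiEtTh2009, §1 p.237 (PDF p.11)] -/
theorem uncountable_K (D : ThetaSetting p) : Uncountable D.K := by
  have h1 : 𝔠 ≤ #ℚ_[p] := continuum_le_cardinal_of_nontriviallyNormedField ℚ_[p]
  haveI : Uncountable ℚ_[p] := Cardinal.aleph0_lt_mk_iff.mp (Cardinal.aleph0_lt_continuum.trans_le h1)
  exact (algebraMap ℚ_[p] D.K).injective.uncountable

/-- The multiplicative group `K^×` of the base field of a theta setting is UNCOUNTABLE (`K` minus one point).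
[cite: MochizukiEtTh2009, §1 p.237 (PDF p.11)] -/
theorem uncountable_units_K (D : ThetaSetting p) : Uncountable (D.K)ˣ := by
  haveI := D.uncountable_K
  rw [← not_countable_iff]
  intro h
  haveI : Countable {x : D.K // x ≠ 0} := Countable.of_equiv _ unitsEquivNeZero
  have hK : Countable D.K := by
    refine Function.Surjective.countable (f := fun o : Option {x : D.K // x ≠ 0} => o.elim 0 Subtype.val) fun x => ?_
    by_cases hx : x = 0
    · exact ⟨none, hx.symm⟩
    · exact ⟨some ⟨x, hx⟩, rfl⟩
  exact not_countable hK

end ThetaSetting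

namespace ThetaFrobenioid

variable {C₀ : Type u} [Category.{0} C₀] {D₀ : Type u'} [Category.{v'} D₀] {𝔉 : ThetaFrobenioid.{w} C₀ D₀}

namespace BiratAutAction

namespace ConstantsDictionary

section Consequences

variable {α : 𝔉.BiratAutAction} {p : ℕ} [Fact p.Prime] {D : ThetaSetting p} {E : D.EtaleThetaData} {l : ℕ}
  {Cu : E.DoubleUnderline l} {μ : D.CyclotomeMod l 𝔉.N} {hC : D.Compat} {hS : D.Sec2Hyps}
  {ι : 𝔉.PiX ≃ₜ* (Cu.thetaEnvData μ hC hS).PiX} {m : 𝔉.muTorsion 𝔉.BN 𝔉.N ≃* (Cu.thetaEnvData μ hC hS).mu}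
  {Cst : Subgroup (𝔉.biratUnits 𝔉.BN)} {ν' : Cst →* (PadicAlgCl p)ˣ}
  (hD : ConstantsDictionary α Cu μ hC hS ι m Cst ν')
include hD

/-- **`K^× ↪ 𝔉.K^×` from the dictionary** (law `reaches_K`: "every element of `K^×` is the reading of a constant of `𝔉`"): a choice of
preimages `z ↦ k(z)` with `ν̃(k(z)) = z` is injective, the reading into `ℚ̄_p ⊇ K` being a function.
[cite: MochizukiEtTh2009, Def 3.6 (iii) p.304 (PDF p.78); Lem 5.8 p.331 (PDF p.105)] -/
theorem exists_injective_unitsK_to_constUnits :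
    ∃ g : (D.K)ˣ → 𝔉.Kˣ, Function.Injective g ∧
      ∀ z, ((ν' ⟨𝔉.constEmb (g z), hD.constEmb_mem (g z)⟩ : (PadicAlgCl p)ˣ) : PadicAlgCl p) =
        algebraMap D.K (PadicAlgCl p) (z : D.K) := by
  choose g hg using hD.reaches_K
  refine ⟨g, fun z₁ z₂ h => ?_, hg⟩
  have h' : algebraMap D.K (PadicAlgCl p) (z₁ : D.K) = algebraMap D.K (PadicAlgCl p) (z₂ : D.K) := by
    rw [← hg z₁, ← hg z₂]
    exact congrArg (fun k => ((ν' ⟨𝔉.constEmb k, hD.constEmb_mem k⟩ : (PadicAlgCl p)ˣ) : PadicAlgCl p)) h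
  exact Units.ext ((algebraMap D.K (PadicAlgCl p)).injective h')

/-- **The dictionary identifies the constants of `𝔉` with `K^×`** — print's Def. 3.6 (iii) «the constant field [of the tempered
Frobenioid] is `K`» as a THEOREM of the predicate: the reading `ν̃ ∘ (K^× ↪ O^×(B_N^birat))` is a group isomorphism `𝔉.K^× ⥲ K^×` onto the
units of the setting's base field `K ⊆ ℚ̄_p` (laws `constEmb_read` — into `K`; `reaches_K` — onto `K^×`; `injective` and
`constEmb_injective` — one-to-one).  [cite: MochizukiEtTh2009, Def 3.6 (iii) p.304 (PDF p.78); Lem 5.8 p.331 (PDF p.105)] -/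
theorem exists_mulEquiv_constUnits_unitsK :
    ∃ φ : 𝔉.Kˣ ≃* (D.K)ˣ, ∀ k : 𝔉.Kˣ,
      algebraMap D.K (PadicAlgCl p) ((φ k : (D.K)ˣ) : D.K) =
        ((ν' ⟨𝔉.constEmb k, hD.constEmb_mem k⟩ : (PadicAlgCl p)ˣ) : PadicAlgCl p) := by
  -- the reading of a constant of `𝔉` is a NONZERO element of `K`
  let f : 𝔉.Kˣ → (D.K)ˣ := fun k =>
    Units.mk0 ⟨_, hD.constEmb_read k⟩ fun h =>
      (ν' ⟨𝔉.constEmb k, hD.constEmb_mem k⟩).ne_zero (congrArg Subtype.val h)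
  have hf : ∀ k, algebraMap D.K (PadicAlgCl p) ((f k : (D.K)ˣ) : D.K) =
      ((ν' ⟨𝔉.constEmb k, hD.constEmb_mem k⟩ : (PadicAlgCl p)ˣ) : PadicAlgCl p) := fun _ => rfl
  have hmul : ∀ a b, f (a * b) = f a * f b := fun a b => by
    refine Units.ext (Subtype.ext ?_)
    change ((ν' ⟨𝔉.constEmb (a * b), hD.constEmb_mem (a * b)⟩ : (PadicAlgCl p)ˣ) : PadicAlgCl p) =
      ((ν' ⟨𝔉.constEmb a, hD.constEmb_mem a⟩ : (PadicAlgCl p)ˣ) : PadicAlgCl p) *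
        ((ν' ⟨𝔉.constEmb b, hD.constEmb_mem b⟩ : (PadicAlgCl p)ˣ) : PadicAlgCl p)
    have hab : (⟨𝔉.constEmb (a * b), hD.constEmb_mem (a * b)⟩ : Cst) =
        ⟨𝔉.constEmb a, hD.constEmb_mem a⟩ * ⟨𝔉.constEmb b, hD.constEmb_mem b⟩ :=
      Subtype.ext (map_mul 𝔉.constEmb a b)
    rw [hab, map_mul, Units.val_mul]
  have hinj : Function.Injective f := fun a b h => by
    have h1 : ((ν' ⟨𝔉.constEmb a, hD.constEmb_mem a⟩ : (PadicAlgCl p)ˣ) : PadicAlgCl p) =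
        ((ν' ⟨𝔉.constEmb b, hD.constEmb_mem b⟩ : (PadicAlgCl p)ˣ) : PadicAlgCl p) := by
      rw [← hf a, ← hf b, h]
    have h2 := hD.injective (Units.ext h1)
    exact 𝔉.constEmb_injective (congrArg Subtype.val h2)
  have hsurj : Function.Surjective f := fun z => by
    obtain ⟨k, hk⟩ := hD.reaches_K z
    refine ⟨k, Units.ext ((algebraMap D.K (PadicAlgCl p)).injective ?_)⟩
    rw [hf k, hk]
  exact ⟨MulEquiv.mk' (Equiv.ofBijective f ⟨hinj, hsurj⟩) hmul, hf⟩

/-- **The constants subgroup `Cst ≤ O^×(B_N^birat)` of a dictionary is UNCOUNTABLE**: `K^× ↪ Cst` (`z ↦` the constant read onto `z`)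
and `K^× ⊇ ℚ_p^×` is uncountable.  [cite: MochizukiEtTh2009, Def 3.6 (iv) p.304 (PDF p.78); Lem 5.8 p.331 (PDF p.105)] -/
theorem uncountable_Cst : Uncountable Cst := by
  obtain ⟨g, hg, -⟩ := hD.exists_injective_unitsK_to_constUnits
  haveI := D.uncountable_units_K
  have hinj : Function.Injective fun z : (D.K)ˣ => (⟨𝔉.constEmb (g z), hD.constEmb_mem (g z)⟩ : Cst) :=
    fun z₁ z₂ h => hg (𝔉.constEmb_injective (congrArg Subtype.val h))
  exact hinj.uncountable

/-- **The constant units `𝔉.K^×` of a §5 datum carrying a dictionary are UNCOUNTABLE** (`K^× ↪ 𝔉.K^×`).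
[cite: MochizukiEtTh2009, Def 3.6 (iii) p.304 (PDF p.78); Lem 5.8 p.331 (PDF p.105)] -/
theorem uncountable_constUnits : Uncountable 𝔉.Kˣ := by
  obtain ⟨g, hg, -⟩ := hD.exists_injective_unitsK_to_constUnits
  haveI := D.uncountable_units_K
  exact hg.uncountable

/-- **The constant field `𝔉.K` of a §5 datum carrying a dictionary is UNCOUNTABLE.**
[cite: MochizukiEtTh2009, Def 3.6 (iii) p.304 (PDF p.78)] -/
theorem uncountable_K : Uncountable 𝔉.K := by
  haveI := hD.uncountable_constUnits
  exact (Units.val_injective (α := 𝔉.K)).uncountable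

/-- **The birational units `O^×(B_N^birat)` of a §5 datum carrying a dictionary are UNCOUNTABLE** (`Cst ≤ O^×(B_N^birat)`).
[cite: MochizukiEtTh2009, Lem 5.8 p.331 (PDF p.105)] -/
theorem uncountable_biratUnits : Uncountable (𝔉.biratUnits 𝔉.BN) := by
  haveI := hD.uncountable_Cst
  exact (Subtype.val_injective (p := fun x : 𝔉.biratUnits 𝔉.BN => x ∈ Cst)).uncountable

end Consequences

end ConstantsDictionary

/-! ### The no-go: NO constants dictionary on a countable carrier -/

section NoGo

variable (α : 𝔉.BiratAutAction) {p : ℕ} [Fact p.Prime] {D : ThetaSetting p} {E : D.EtaleThetaData} {l : ℕ}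
  (Cu : E.DoubleUnderline l) (μ : D.CyclotomeMod l 𝔉.N) (hC : D.Compat) (hS : D.Sec2Hyps)
  (ι : 𝔉.PiX ≃ₜ* (Cu.thetaEnvData μ hC hS).PiX) (m : 𝔉.muTorsion 𝔉.BN 𝔉.N ≃* (Cu.thetaEnvData μ hC hS).mu)

/-- **NO dictionary on a countable subgroup of constants**: if `Cst ≤ O^×(B_N^birat)` is countable, then for NO reading `ν̃ : Cst → ℚ̄_p^×` is
`ConstantsDictionary α Cu μ hC hS ι m Cst ν̃` satisfiable — whatever `α`, `ι`, `m`.  [cite: MochizukiEtTh2009, Lem 5.8 p.331 (PDF p.105)] -/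
theorem not_constantsDictionary_of_countable_Cst (Cst : Subgroup (𝔉.biratUnits 𝔉.BN)) [Countable Cst]
    (ν' : Cst →* (PadicAlgCl p)ˣ) : ¬ ConstantsDictionary α Cu μ hC hS ι m Cst ν' :=
  fun hD => (not_countable_iff.mpr hD.uncountable_Cst) ‹Countable Cst›

/-- **NO dictionary on a §5 datum with countably many birational units** (`O^×(B_N^birat)` countable — e.g. the tower skeletons of
record with finitely generated function groups, `Fn = ℤ × ℤ`, `μ₂ × ℤ³`, `A × ℤ^k` with `A` finite): for NO `Cst`, `ν̃` (and no `α, ι, m`)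
is the dictionary binder `hD` satisfiable.  [cite: MochizukiEtTh2009, Lem 5.8 p.331 (PDF p.105)] -/
theorem not_constantsDictionary_of_countable_biratUnits [Countable (𝔉.biratUnits 𝔉.BN)]
    (Cst : Subgroup (𝔉.biratUnits 𝔉.BN)) (ν' : Cst →* (PadicAlgCl p)ˣ) : ¬ ConstantsDictionary α Cu μ hC hS ι m Cst ν' :=
  fun hD => (not_countable_iff.mpr hD.uncountable_biratUnits) ‹Countable (𝔉.biratUnits 𝔉.BN)›

/-- **NO dictionary on a §5 datum with a countable constant field `𝔉.K`** (e.g. `K := ℚ`): the dictionary would make `𝔉.K^× ≅ K^× ⊇ ℚ_p^×`.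
[cite: MochizukiEtTh2009, Def 3.6 (iii) p.304 (PDF p.78)] -/
theorem not_constantsDictionary_of_countable_K [Countable 𝔉.K] (Cst : Subgroup (𝔉.biratUnits 𝔉.BN))
    (ν' : Cst →* (PadicAlgCl p)ˣ) : ¬ ConstantsDictionary α Cu μ hC hS ι m Cst ν' :=
  fun hD => (not_countable_iff.mpr hD.uncountable_K) ‹Countable 𝔉.K›

/-- **Existential form of the no-go** (the shape of the junction's `hD`-slot): over a §5 datum with countably many birational units there
is NO pair (constants subgroup, reading) whatsoever satisfying the dictionary.  [cite: MochizukiEtTh2009, Lem 5.8 p.331 (PDF p.105)] -/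
theorem not_exists_constantsDictionary_of_countable_biratUnits [Countable (𝔉.biratUnits 𝔉.BN)] :
    ¬ ∃ (Cst : Subgroup (𝔉.biratUnits 𝔉.BN)) (ν' : Cst →* (PadicAlgCl p)ˣ), ConstantsDictionary α Cu μ hC hS ι m Cst ν' :=
  fun ⟨Cst, ν', hD⟩ => not_constantsDictionary_of_countable_biratUnits α Cu μ hC hS ι m Cst ν' hD

end NoGo

/-! ### The ∀-closure refuted as a schema, closed form, at the record model `modelχ` -/

/-- **The ∀-closure «every §5 datum over a theta setting's §2 model admits a constants dictionary» is FALSE (schema refutation, closed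
form).**  Witness at the record model `modelχ p` (`l = N = 1`, abc-iut-L2-d1's `doubleUnderlineχSec`, abc-iut-L2-t8's cyclotome
identification and §1/§2 hypotheses BY NAME): this lineage's toy §5 datum `CnstToy.datum` (`Aut_C(B_N) = μ_N(J_N) ⋊ Γ` over `BΓ`, birational
units `J_N^×`, `ρ`, `s^⊓-gp_N := inr`, natural action `actHom`, `ι := refl`, `m := muEquiv`) with its constant field REPLACED by the
countable field `ℚ` (constants `ℚ^× ↪ K^× ↪ J_N^×`, still fixed by `Aut_C(B_N)`) — a legitimate inhabitant of the free structure
`ThetaFrobenioid`, on which `not_constantsDictionary_of_countable_K` bites.  Census pair: the honest-slot INSTANCE is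
`CnstToy.constantsDictionary_datum` / `CnstToy.exists_constantsDictionary_modelχ` (constant field `K` itself).
[cite: MochizukiEtTh2009, Def 3.6 (iii) p.304 (PDF p.78); Lem 5.8 p.331 (PDF p.105)] -/
theorem not_forall_exists_constantsDictionary (p : ℕ) [Fact p.Prime] :
    ¬ ∀ {C : Type} [Category.{0} C] {B : Type} [Category.{0} B] (𝔉 : ThetaFrobenioid.{0} C B) (α : 𝔉.BiratAutAction)
        {D : ThetaSetting p} {E : D.EtaleThetaData} {l : ℕ} (Cu : E.DoubleUnderline l) (μ : D.CyclotomeMod l 𝔉.N)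
        (hC : D.Compat) (hS : D.Sec2Hyps) (ι : 𝔉.PiX ≃ₜ* (Cu.thetaEnvData μ hC hS).PiX)
        (m : 𝔉.muTorsion 𝔉.BN 𝔉.N ≃* (Cu.thetaEnvData μ hC hS).mu),
        ∃ (Cst : Subgroup (𝔉.biratUnits 𝔉.BN)) (ν' : Cst →* (PadicAlgCl p)ˣ), ConstantsDictionary α Cu μ hC hS ι m Cst ν' := by
  intro h
  obtain ⟨μ⟩ := SettingModel.modelχ_nonempty_cyclotomeMod p (l := ((1 : ℕ+) : ℕ)) one_pos 1
  let hS : (ThetaSetting.modelχ p).Sec2Hyps := ThetaSetting.modelχ_sec2Hyps p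
  let Cu := SettingModel.doubleUnderlineχSec p 1 odd_one
  -- the countable-constants variant of the toy datum: constants `ℚ^× ↪ K^× ↪ J_N^×`
  let cE : ℚˣ →* (CnstToy.J (ThetaSetting.modelχ p) 1)ˣ :=
    (CnstToy.constEmb (ThetaSetting.modelχ p) 1).comp (Units.map (algebraMap ℚ (ThetaSetting.modelχ p).K).toMonoidHom)
  have cE_inj : Function.Injective cE :=
    (CnstToy.constEmb_injective (ThetaSetting.modelχ p) 1).comp
      (Units.map_injective (algebraMap ℚ (ThetaSetting.modelχ p).K).injective)
  let 𝔉' : ThetaFrobenioid.{0} (SingleObj (CnstToy.G (ThetaSetting.modelχ p) 1)) (SingleObj (CnstToy.Gam (ThetaSetting.modelχ p) 1)) :=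
    { CnstToy.datum Cu μ hS.compat hS with
      K := ℚ
      instFieldK := inferInstance
      constEmb := cE
      constEmb_injective := cE_inj }
  let α' : 𝔉'.BiratAutAction :=
    { act := CnstToy.actHom Cu μ hS.compat hS
      act_unitsToBirat := CnstToy.actHom_unitsToBirat Cu μ hS.compat hS
      act_units := CnstToy.actHom_units Cu μ hS.compat hS
      act_constEmb := fun e k =>
        CnstToy.actHom_constEmb Cu μ hS.compat hS e (Units.map (algebraMap ℚ (ThetaSetting.modelχ p).K).toMonoidHom k) }
  obtain ⟨Cst, ν', hD⟩ := h 𝔉' α' Cu μ hS.compat hS (ContinuousMulEquiv.refl _) (CnstToy.muEquiv Cu μ hS.compat hS)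
  haveI : Countable 𝔉'.K := inferInstanceAs (Countable ℚ)
  exact not_constantsDictionary_of_countable_K α' Cu μ hS.compat hS _ _ Cst ν' hD

end BiratAutAction

end ThetaFrobenioid

end Literature.AnabelianGeometry.EtaleTheta

end
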